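import Literature.NumberTheory.EllipticCurves.ModularSymbolsManinDrinfeldProofs
import HarnessLib

/-!
# `[r]⁺_f ∈ ℚ` for rational newforms, unconditionally
# (provefact `Literature.NumberTheory.EllipticCurves.ModularForms.IsNewform0.exists_normalizedPlusSymbol_eq_ratCast`)

D-0014 keeps `Literature/` sorry-free by stating cited results as named facts `def X : Prop`.
This sibling file of `Literature.NumberTheory.EllipticCurves.ModularSymbols` discharges, sorry-free
and without any hypothesis, the named fact

* `IsNewform0.exists_normalizedPlusSymbol_eq_ratCast` (Mazur–Tate–Teitelbaum 1986, §I.8: for a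
  newform `f ∈ S₂(Γ₀(N))` with rational Fourier coefficients the normalised modular symbols
  `[r]⁺_f = re (plusSymbol f r) / Ω⁺_f`, `r ∈ ℚ`, are rational numbers)

as `IsNewform0.exists_normalizedPlusSymbol_eq_ratCast_holds`, and proves the twin statement for
`[r]⁻_f = im (minusSymbol f r) / Ω⁻_f` (`IsNewform0.exists_normalizedMinusSymbol_eq_ratCast`).

## The argument

The rationality of `[r]^±` is the Manin–Drinfeld theorem: Manin 1972, Thm. 3.3, (20) and
Thm. 3.5, (22) ("closing the path of integration" with a Hecke operator `T_l`, `l ≡ 1 (mod N)`),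
and the remark after Thm. 3.5 (Engl. transl. p. 35): "the case when the eigenvalues of `T_m` on `Φ`
are rational is especially interesting: it then follows from (21) and (22) that the corresponding
arguments of all the parabolic points of `X_N(ℂ)` are rational linear combinations of the
fundamental periods" (Cor. 3.6). In the tree this is the theorem
`exists_nsmul_modularSymbol_mem_periodLattice_of_isNewform0` of
`Literature.NumberTheory.EllipticCurves.ModularSymbolsManinDrinfeldProofs`: for a normalised
newform `f` with rational coefficients and every `r ∈ ℚ`, `n • {∞, r}_f ∈ Λ_f` for some `n > 0`.

From there **no lattice property of `Λ_f` (Eichler–Shimura) is needed**, because of the way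
`Ω⁺_f = plusPeriod f` is normalised in `ModularSymbols`: either `re Λ_f = ℤ · (Ω⁺_f / 2)` with
`Ω⁺_f > 0` — and then `n • {∞, ±r}_f ∈ Λ_f` gives `re {∞, ±r}_f ∈ ℚ · Ω⁺_f`
(`exists_rat_re_eq_of_nsmul_mem`), whence
`[r]⁺_f = (re {∞, r}_f + re {∞, -r}_f) / (2 Ω⁺_f) ∈ ℚ` — or `re Λ_f` is not infinite cyclic, in which
case `Ω⁺_f` is the documented junk value `0` and `[r]⁺_f = re (plusSymbol f r) / 0 = 0 ∈ ℚ`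
(`plusPeriod_eq_zero_or`). (The earlier reduction
`IsNewform0.exists_normalizedPlusSymbol_eq_ratCast_of_closure_pair` of
`ModularSymbolsManinDrinfeldProofs` went through `IsNewform0.exists_rat_smul_plusPeriod`, whose
first clause `Ω⁺_f ≠ 0` genuinely needs Eichler–Shimura; the rationality clause does not.) The
same dichotomy for `Ω⁻_f = minusPeriod f` and `im` (`minusPeriod_eq_zero_or`,
`exists_rat_im_eq_of_nsmul_mem`) gives `[r]⁻_f ∈ ℚ`.

So for *every* `f ∈ S₂(Γ₀(N))` whose modular symbols satisfy Manin–Drinfeld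
(`exists_nsmul_modularSymbol_mem_periodLattice f`), all `[r]^±_f` are rational
(`exists_normalizedPlusSymbol_eq_ratCast_of_exists_nsmul`,
`exists_normalizedMinusSymbol_eq_ratCast_of_exists_nsmul`); rational newforms satisfy it.

## References

* B. Mazur, J. Tate, J. Teitelbaum, *On `p`-adic analogues of the conjectures of Birch and
  Swinnerton-Dyer*, Invent. Math. 84 (1986), 1–48, §I.8 (the symbols `[a/m]^±` and their
  rationality), doi:10.1007/bf01388731.
* Ju. I. Manin, *Parabolic points and zeta functions of modular curves*, Izv. Akad. Nauk SSSR
  Ser. Mat. 36 (1972), 19–66; Engl. transl. Math. USSR-Izv. 6 (1972), 19–64,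
  doi:10.1070/IM1972v006n01ABEH001867: Thm. 3.3, (20); Thm. 3.5, (22) and the remark after it
  (p. 35 of the translation); Cor. 3.6.
* V. G. Drinfeld, *Two theorems on modular curves*, Funct. Anal. Appl. 7 (1973), 155–156.
* J. E. Cremona, *Algorithms for modular elliptic curves*, 2nd ed., CUP 1997, §2.8.
-/

noncomputable section

open scoped MatrixGroups ModularForm

open CongruenceSubgroup Complex

namespace Literature.NumberTheory.EllipticCurves.ModularForms

/-! ### The dichotomy built into `Ω^±_f` -/

section Periods

variable {N : ℕ} (f : CuspForm (Gamma0 N) 2)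

/-- **The dichotomy defining `Ω⁺_f`**: either `Ω⁺_f = plusPeriod f` is the junk value `0`, or
`Ω⁺_f > 0` and `re Λ_f = ℤ · (Ω⁺_f / 2)` (unfolding the `dite` in `plusPeriod`; Cremona 1997,
§2.8: "`Ω(f)` is twice the least positive real part of a period"). [folklore] -/
theorem plusPeriod_eq_zero_or :
    plusPeriod f = 0 ∨
      (0 < plusPeriod f ∧ realPeriods f = AddSubgroup.zmultiples (plusPeriod f / 2)) := by
  classical
  by_cases h : ∃ Ω : ℝ, 0 < Ω ∧ realPeriods f = AddSubgroup.zmultiples (Ω / 2)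
  · have hΩ : plusPeriod f = h.choose := by simp only [plusPeriod, dif_pos h]
    exact Or.inr (hΩ ▸ h.choose_spec)
  · exact Or.inl (by simp only [plusPeriod, dif_neg h])

/-- **The dichotomy defining `Ω⁻_f`**: either `Ω⁻_f = minusPeriod f = 0` (junk), or `Ω⁻_f > 0`
and `im Λ_f = ℤ · (Ω⁻_f / 2)`. [folklore] -/
theorem minusPeriod_eq_zero_or :
    minusPeriod f = 0 ∨
      (0 < minusPeriod f ∧ imagPeriods f = AddSubgroup.zmultiples (minusPeriod f / 2)) := by
  classical
  by_cases h : ∃ Ω : ℝ, 0 < Ω ∧ imagPeriods f = AddSubgroup.zmultiples (Ω / 2)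
  · have hΩ : minusPeriod f = h.choose := by simp only [minusPeriod, dif_pos h]
    exact Or.inr (hΩ ▸ h.choose_spec)
  · exact Or.inl (by simp only [minusPeriod, dif_neg h])

end Periods

/-! ### `[r]^± ∈ ℚ` from Manin–Drinfeld alone -/

section Rationality

variable {N : ℕ} {f : CuspForm (Gamma0 N) 2}

/-- **`[r]⁺_f ∈ ℚ` for every cusp form satisfying Manin–Drinfeld.** If every modular symbol
`{∞, r}_f` has a positive multiple in the period lattice `Λ_f`
(`exists_nsmul_modularSymbol_mem_periodLattice f`; Manin 1972, Thm. 3.5, Cor. 3.6; Drinfeld 1973),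
then `normalizedPlusSymbol f r = re (plusSymbol f r) / Ω⁺_f` is rational for every `r ∈ ℚ`: if
`re Λ_f = ℤ · (Ω⁺_f/2)` then `re {∞, ±r}_f ∈ ℚ · Ω⁺_f` (`exists_rat_re_eq_of_nsmul_mem`), and
otherwise `Ω⁺_f = 0` and the quotient is `0` (`plusPeriod_eq_zero_or`). No lattice property of
`Λ_f` is used (Mazur–Tate–Teitelbaum 1986, §I.8; Cremona 1997, §2.8).
[cite: Manin1972, Thm. 3.5 and Cor. 3.6] -/
theorem exists_normalizedPlusSymbol_eq_ratCast_of_exists_nsmul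
    (H : exists_nsmul_modularSymbol_mem_periodLattice f) (r : ℚ) :
    ∃ q : ℚ, normalizedPlusSymbol f r = q := by
  rcases plusPeriod_eq_zero_or f with h0 | ⟨hpos, hre⟩
  · exact ⟨0, by rw [normalizedPlusSymbol, h0, div_zero, Rat.cast_zero]⟩
  · obtain ⟨n, hn, hnr⟩ := H r
    obtain ⟨n', hn', hnr'⟩ := H (-r)
    obtain ⟨q, hq⟩ := exists_rat_re_eq_of_nsmul_mem hre hn hnr
    obtain ⟨q', hq'⟩ := exists_rat_re_eq_of_nsmul_mem hre hn' hnr'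
    refine ⟨(q + q') / 2, ?_⟩
    rw [normalizedPlusSymbol, plusSymbol, Complex.div_ofNat_re, Complex.add_re, hq, hq',
      div_eq_iff hpos.ne']
    push_cast
    ring

/-- **`[r]⁻_f ∈ ℚ` for every cusp form satisfying Manin–Drinfeld**: the twin of
`exists_normalizedPlusSymbol_eq_ratCast_of_exists_nsmul` for
`normalizedMinusSymbol f r = im (minusSymbol f r) / Ω⁻_f`, via `minusPeriod_eq_zero_or` and
`exists_rat_im_eq_of_nsmul_mem` (Mazur–Tate–Teitelbaum 1986, §I.8; Manin 1972, Thm. 3.5, Cor. 3.6).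
[cite: Manin1972, Thm. 3.5 and Cor. 3.6] -/
theorem exists_normalizedMinusSymbol_eq_ratCast_of_exists_nsmul
    (H : exists_nsmul_modularSymbol_mem_periodLattice f) (r : ℚ) :
    ∃ q : ℚ, normalizedMinusSymbol f r = q := by
  rcases minusPeriod_eq_zero_or f with h0 | ⟨hpos, him⟩
  · exact ⟨0, by rw [normalizedMinusSymbol, h0, div_zero, Rat.cast_zero]⟩
  · obtain ⟨n, hn, hnr⟩ := H r
    obtain ⟨n', hn', hnr'⟩ := H (-r)
    obtain ⟨q, hq⟩ := exists_rat_im_eq_of_nsmul_mem him hn hnr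
    obtain ⟨q', hq'⟩ := exists_rat_im_eq_of_nsmul_mem him hn' hnr'
    refine ⟨(q - q') / 2, ?_⟩
    rw [normalizedMinusSymbol, minusSymbol, Complex.div_ofNat_im, Complex.sub_im, hq, hq',
      div_eq_iff hpos.ne']
    push_cast
    ring

variable [NeZero N]

/-- Discharge of the named fact `IsNewform0.exists_normalizedPlusSymbol_eq_ratCast` of
`ModularSymbols`: **for a normalised newform `f ∈ S₂(Γ₀(N))` with rational Fourier coefficients,
`[r]⁺_f ∈ ℚ` for every `r ∈ ℚ`** (Mazur–Tate–Teitelbaum 1986, §I.8). Proof: Manin–Drinfeld for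
rational newforms (`exists_nsmul_modularSymbol_mem_periodLattice_of_isNewform0`, Manin 1972,
Thm. 3.5 and Cor. 3.6: with rational Hecke eigenvalues "the arguments of all the parabolic points
are rational linear combinations of the fundamental periods") and
`exists_normalizedPlusSymbol_eq_ratCast_of_exists_nsmul`.
[cite: MazurTateTeitelbaum1986Invent, §I.8] -/
theorem IsNewform0.exists_normalizedPlusSymbol_eq_ratCast_holds :
    IsNewform0.exists_normalizedPlusSymbol_eq_ratCast (f := f) := fun hf hQ r ↦
  exists_normalizedPlusSymbol_eq_ratCast_of_exists_nsmul
    (exists_nsmul_modularSymbol_mem_periodLattice_of_isNewform0 hf hQ) r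

/-- **`[r]⁻_f ∈ ℚ` for a normalised newform `f ∈ S₂(Γ₀(N))` with rational Fourier coefficients**
and every `r ∈ ℚ` (Mazur–Tate–Teitelbaum 1986, §I.8), by Manin–Drinfeld
(`exists_nsmul_modularSymbol_mem_periodLattice_of_isNewform0`) and
`exists_normalizedMinusSymbol_eq_ratCast_of_exists_nsmul`.
[cite: MazurTateTeitelbaum1986Invent, §I.8] -/
theorem IsNewform0.exists_normalizedMinusSymbol_eq_ratCast (hf : IsNewform0 f)
    (hQ : coeffField f = ⊥) (r : ℚ) : ∃ q : ℚ, normalizedMinusSymbol f r = q :=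
  exists_normalizedMinusSymbol_eq_ratCast_of_exists_nsmul
    (exists_nsmul_modularSymbol_mem_periodLattice_of_isNewform0 hf hQ) r

end Rationality

end Literature.NumberTheory.EllipticCurves.ModularForms
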